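import Summits.QuantumFields.YangMills.Theorems.VirialFluxGapRingSliceFreeTransversality
import Summits.QuantumFields.YangMills.Theorems.VirialFluxGapFixOrbitSeparation
import Summits.QuantumFields.YangMills.Theorems.VirialFluxGapAnchorSliceAngle
import Summits.QuantumFields.YangMills.Theorems.VirialFluxGapRingTreeGaugeZeroSet
import HarnessLib

/-!
# ★★ QUADRATIC GROWTH of the ring deficit on the ANCHOR SLICE: `κ_L · ‖(a, b)‖²_{ℓ²} ≤ F_z(e^{(a,b)}·R_s)` — the coercivity input
# (item (a), `hgrowth` of ✓`coercive_of_quadratic_growth` ∕ `hcoer` of ✓`laplaceMethod_quantitative_orbit_tube`) of the DIRECT Laplace road to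
# ⟨stmt-QuantumFields-24204⟩ `VirialFluxGap.SharpTwistedLaplace`

Helper module (free-hands work of width seat ym-line-sfw-p2-w2 g50, cell ym-idea-1; `--supports 24204`).  In QUATERNION letters (`su2Quat`, the
letters of the anchor programme ✓`VirialFluxGapAnchorChartDefs`) a ring history `P` near the reference ring `R_s = (combFlat w_s ; λ·C₀)` of
✓`exists_skew_linearised_le_sqrt_ringDeficit` (Cor B) is read as `su2Quat(P_{i,e}) = e^{a_{i,e}}·su2Quat(combFlat w_s e)`,
`su2Quat(P.2 x) = e^{b_x}·su2Quat(λ_x C₀)` with IMAGINARY `a, b`.  The ANCHOR SLICE conditions are: tree gauge on slice `0` (`a 0 e = 0` on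
✓`treeEdge`), seam anchor `b 0 ∈ ℝ·su2Quat C₀`, link anchor `a 0 e₀ ⊥ su2Quat C₀` at the wrap link `e₀ = ((−1,−1,−1), k₀)` with `z k₀ = true`.
* §1 the bridge Cor B (Frobenius-normed `2×2` matrices) → quaternions: `‖quatMatrix q‖_F = √2‖q‖`,
  `𝔰𝔲(2) = quatMatrix(Im ℍ)`, and `quatMatrix` of a linearised gauge mode;
* §2 `growth_arith` — the real arithmetic;
* §3 ★★ `ringDeficit_quadratic_growth_anchorSlice` — if all `‖a i e‖, ‖b x‖ ≤ 1/(10⁷·L¹¹)` then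
  `Σ_i Σ_e ‖a i e‖² + Σ_x ‖b x‖² ≤ 10²²·L³³ · F_z(P)`
  (✓Cor B with `m = √(2Q)` + ✓`anchorSlice_angle`; every polynomial is admissible for the leaf, the exponent is not optimised).
Everything here is PROVED; no definitions, no named facts (namespace `Summit.QuantumFields.YangMills.Theorems.VirialFluxGap.AnchorSlice`).

HONEST FRAMING: bookkeeping over landed results; ⟨24204⟩, ⟨24319⟩, ⟨22884⟩ and every rung stay OPEN; the Yang–Mills mass gap (Clay) is NOT touched; no
summit is proved by a line.

## References
* M. Lüscher, Nucl. Phys. B219 (1983), §2. [Luscher1983]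
* A. González-Arroyo, C. P. Korthals Altes, Nucl. Phys. B311 (1988), §2. [GonzalezarroyoAltes1988]
-/

set_option autoImplicit false

noncomputable section

open scoped Quaternion RealInnerProductSpace Matrix Matrix.Norms.Frobenius BigOperators
open NormedSpace
open Literature.MathematicalPhysics.QuantumFieldTheory hiding SU2 su2Quat_mul
open Literature.MathematicalPhysics.QuantumLattice
open Literature.MathematicalPhysics.QuantumFieldTheory.Balaban1983to89.T4HaarSU2Translate (su2Quat_mul)
open Literature.MathematicalPhysics.QuantumFieldTheory.Balaban1983to89.T4WilsonLinkAffine (su2Quat_inv)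
open Literature.MathematicalPhysics.QuantumFieldTheory.Balaban1983to89 (T4QuatExpLog.quatMatrixRingHom T4QuatExpLog.quatMatrixRingHom_apply)
open Literature.MathematicalPhysics.QuantumFieldTheory.Balaban1983to89.T4QuatExpLog (quatMatrix_exp)
open Summit.QuantumFields.YangMills.Theorems.FemtoTransferGap
open Summit.QuantumFields.YangMills.Theorems.FemtoTransferGap.TT
open Summit.QuantumFields.YangMills.Theorems.FemtoTransferGap.TwoLattice
open Summit.QuantumFields.YangMills.Theorems.FemtoTransferGap.TwoLattice.Flat
open Summit.QuantumFields.YangMills.Theorems.ToronValleyVolume.Lojasiewicz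
open Summit.QuantumFields.YangMills.Theorems.TwistEaterVolume.Quadratic
open Summit.QuantumFields.YangMills.Theorems.VirialFluxGap.RingDeficit
open Summit.QuantumFields.YangMills.Theorems.VirialFluxGap.ChartPhase (exists_skew_linearised_le_sqrt_ringDeficit)
open Summit.QuantumFields.YangMills.Theorems.QuantitativeLaplace (not_treeEdge_wrap su2Quat_centreElem)

namespace Summit.QuantumFields.YangMills.Theorems.VirialFluxGap.AnchorSlice

/-! ## §1 The bridge between Frobenius-normed `2 × 2` matrices and quaternions -/

/-- The FROBENIUS norm of `quatMatrix q` is `√2·‖q‖`. [folklore] -/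
theorem frob_norm_quatMatrix (q : ℍ) : ‖quatMatrix q‖ = Real.sqrt 2 * ‖q‖ := by
  have hc : ∀ a b : ℝ, ‖(⟨a, b⟩ : ℂ)‖ ^ 2 = a ^ 2 + b ^ 2 := fun a b => by rw [Complex.sq_norm, Complex.normSq_mk]; ring
  have h : ‖quatMatrix q‖ ^ 2 = 2 * ‖q‖ ^ 2 := by
    rw [← frobNorm_eq_norm, frobNorm, Real.sq_sqrt (by positivity), Fin.sum_univ_two, Fin.sum_univ_two, Fin.sum_univ_two,
      quatMatrix_apply_00, quatMatrix_apply_01, quatMatrix_apply_10, quatMatrix_apply_11, hc, hc, hc, hc, sq_norm_eq_sum_sq]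
    ring
  have h0 : 0 ≤ ‖quatMatrix q‖ := norm_nonneg _
  have h1 : 0 ≤ Real.sqrt 2 * ‖q‖ := by positivity
  have h2 : (Real.sqrt 2 * ‖q‖) ^ 2 = 2 * ‖q‖ ^ 2 := by rw [mul_pow, Real.sq_sqrt (by norm_num)]
  nlinarith [h, h2, h0, h1, sq_nonneg (‖quatMatrix q‖ - Real.sqrt 2 * ‖q‖)]

/-- `𝔰𝔲(2) = quatMatrix(Im ℍ)`, FAMILY form: a family of traceless skew-Hermitian `2 × 2` matrices is `quatMatrix` of a family of imaginary
quaternions (the pointwise statement is ✓`NE7b.SU2EulerLagrangeBridge.exists_eq_quatMatrix_of_skewHermitian`, outside this file's import cone;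
re-derived here from the entries). [folklore] -/
theorem exists_pure_family_quatMatrix_eq {α : Type*} {ξ : α → Matrix (Fin 2) (Fin 2) ℂ} (hX : ∀ x, (ξ x)ᴴ = -ξ x)
    (htr : ∀ x, (ξ x).trace = 0) : ∃ η : α → ℍ, ∀ x, (η x).re = 0 ∧ quatMatrix (η x) = ξ x := by
  refine ⟨fun x => ⟨0, (ξ x 0 0).im, (ξ x 0 1).re, (ξ x 0 1).im⟩, fun x => ⟨rfl, ?_⟩⟩
  have h00 := congrArg (fun M : Matrix (Fin 2) (Fin 2) ℂ => M 0 0) (hX x)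
  have h10 := congrArg (fun M : Matrix (Fin 2) (Fin 2) ℂ => M 1 0) (hX x)
  simp only [Matrix.conjTranspose_apply, Matrix.neg_apply] at h00 h10
  have htr' := htr x
  rw [Matrix.trace_fin_two] at htr'
  have hre0 : (ξ x 0 0).re = 0 := by have := congrArg Complex.re h00; simp at this; linarith
  ext i j
  fin_cases i <;> fin_cases j
  · simp [quatMatrix, Complex.ext_iff, hre0]
  · simp [quatMatrix]
  · have hre : (ξ x 1 0).re = -(ξ x 0 1).re := by have := congrArg Complex.re h10; simp at this; linarith
    have him : (ξ x 1 0).im = (ξ x 0 1).im := by have := congrArg Complex.im h10; simp at this; linarith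
    simp [quatMatrix, Complex.ext_iff, hre, him]
  · have hre : (ξ x 1 1).re = 0 := by have := congrArg Complex.re htr'; simp at this; linarith
    have him : (ξ x 1 1).im = -(ξ x 0 0).im := by have := congrArg Complex.im htr'; simp at this; linarith
    simp [quatMatrix, Complex.ext_iff, hre, him]

/-- `quatMatrix` of a linearised gauge mode: `quatMatrix a + (quatMatrix η − R·quatMatrix η'·Rᴴ) = quatMatrix(a + (η − r η' r*))` for
`R = quatMatrix r`. [folklore] -/
theorem quatMatrix_gaugeMode (a η η' r : ℍ) :
    quatMatrix a + (quatMatrix η - quatMatrix r * quatMatrix η' * (quatMatrix r)ᴴ) = quatMatrix (a + (η - r * η' * star r)) := by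
  have h := map_add T4QuatExpLog.quatMatrixRingHom a (η - r * η' * star r)
  rw [map_sub, map_mul, map_mul] at h
  simp only [T4QuatExpLog.quatMatrixRingHom_apply] at h
  rw [← Literature.Geometry.GaugeTheory.quatMatrix_star, ← h]

/-! ## §2 The real arithmetic -/

/-- The arithmetic of the quadratic-growth constant (no optimisation attempted). [folklore] -/
theorem growth_arith {L Q S F : ℝ} (hL : 1 ≤ L) (hQ0 : 0 ≤ Q) (hS0 : 0 ≤ S) (hF0 : 0 ≤ F)
    (hQS : Q ≤ 9600 * L ^ 9 * S)
    (hcor : Real.sqrt (2 * S) ≤ Real.sqrt (220000 * L ^ 8 * F) + 2500 * L ^ 4 * (2 * Q + 110000 * L ^ 8 * F))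
    (hQsmall : Q * (10 ^ 12 * L ^ 17) ≤ 1) : Q ≤ 10 ^ 22 * L ^ 33 * F := by
  have hL0 : 0 ≤ L := by linarith
  have hL4 : 0 ≤ L ^ 4 := by positivity
  have hsF0 : 0 ≤ Real.sqrt F := Real.sqrt_nonneg F
  have hsF2 : Real.sqrt F ^ 2 = F := Real.sq_sqrt hF0
  -- `√(220000 L⁸ F) ≤ 470 L⁴ √F`
  have hsqrt1 : Real.sqrt (220000 * L ^ 8 * F) ≤ 470 * L ^ 4 * Real.sqrt F := by
    have e : 470 * L ^ 4 * Real.sqrt F = Real.sqrt ((470 * L ^ 4) ^ 2 * F) := by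
      rw [Real.sqrt_mul (sq_nonneg _), Real.sqrt_sq (by positivity)]
    rw [e]
    exact Real.sqrt_le_sqrt (by nlinarith [pow_nonneg hL0 8])
  -- `2S ≤ R²`
  set R : ℝ := 470 * L ^ 4 * Real.sqrt F + 2500 * L ^ 4 * (2 * Q + 110000 * L ^ 8 * F) with hR
  have hR0 : 0 ≤ R := by positivity
  have hcor' : Real.sqrt (2 * S) ≤ R := by linarith
  have h2S : 2 * S ≤ R ^ 2 := by
    have h := pow_le_pow_left₀ (Real.sqrt_nonneg _) hcor' 2
    rwa [Real.sq_sqrt (by linarith)] at h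
  -- `R² ≤ 3(…)`
  have hR2 : R ^ 2 ≤ 3 * (220900 * L ^ 8 * F + 25000000 * L ^ 8 * Q ^ 2 + 75625 * 10 ^ 12 * L ^ 24 * F ^ 2) := by
    have e : R = 470 * L ^ 4 * Real.sqrt F + 5000 * L ^ 4 * Q + 275000000 * L ^ 12 * F := by rw [hR]; ring
    rw [e]
    have h3 : ∀ p q r : ℝ, (p + q + r) ^ 2 ≤ 3 * (p ^ 2 + q ^ 2 + r ^ 2) := fun p q r => by
      nlinarith [sq_nonneg (p - q), sq_nonneg (q - r), sq_nonneg (p - r)]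
    refine (h3 _ _ _).trans (le_of_eq ?_)
    rw [mul_pow, mul_pow, hsF2]; ring
  -- the `Q²` term is absorbed
  have hQQ : 25000000 * L ^ 8 * Q ^ 2 * (14400 * L ^ 9) ≤ 36 / 100 * Q := by
    have h1 : Q * (10 ^ 12 * L ^ 17) * Q ≤ 1 * Q := mul_le_mul_of_nonneg_right hQsmall hQ0
    nlinarith [h1]
  have hmain : Q ≤ 4800 * L ^ 9 * R ^ 2 := by nlinarith [hQS, h2S, pow_nonneg hL0 9]
  have hmain2 : 64 / 100 * Q ≤ 14400 * L ^ 9 * (220900 * L ^ 8 * F + 75625 * 10 ^ 12 * L ^ 24 * F ^ 2) := by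
    nlinarith [hmain, hR2, hQQ, pow_nonneg hL0 9]
  -- case analysis on `F ≤ 1`
  have hL17 : L ^ 17 ≤ L ^ 33 := pow_le_pow_right₀ hL (by norm_num)
  have hL17' : 1 ≤ L ^ 17 := one_le_pow₀ hL
  rcases le_or_gt F 1 with hF1 | hF1
  · have hF2 : F ^ 2 ≤ F := by nlinarith
    have h1 : 14400 * L ^ 9 * (220900 * L ^ 8 * F + 75625 * 10 ^ 12 * L ^ 24 * F ^ 2) ≤
        14400 * (220900 + 75625 * 10 ^ 12) * L ^ 33 * F := by
      have e1 : L ^ 9 * L ^ 8 = L ^ 17 := by ring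
      have e2 : L ^ 9 * L ^ 24 = L ^ 33 := by ring
      nlinarith [mul_le_mul_of_nonneg_right hL17 hF0, mul_le_mul_of_nonneg_left hF2 (by positivity : (0:ℝ) ≤ L ^ 33),
        pow_nonneg hL0 33, pow_nonneg hL0 17]
    nlinarith [h1, pow_nonneg hL0 33]
  · have h1 : Q ≤ 1 := by
      have : Q * 1 ≤ Q * (10 ^ 12 * L ^ 17) := mul_le_mul_of_nonneg_left (by nlinarith) hQ0
      linarith
    have h2 : (1 : ℝ) ≤ 10 ^ 22 * L ^ 33 * F := by
      have : (1 : ℝ) ≤ L ^ 33 := one_le_pow₀ hL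
      nlinarith
    linarith

/-! ## §3 Quadratic growth on the anchor slice -/

/-- The orthogonality of the reference pair in quaternion letters. [folklore] -/
theorem inner_su2Quat_CN_eq_zero {N₀ C₀ : SU2} (hC : (su2Quat C₀).re = 0)
    (hNC : (su2Quat N₀).imI * (su2Quat C₀).imI + (su2Quat N₀).imJ * (su2Quat C₀).imJ + (su2Quat N₀).imK * (su2Quat C₀).imK = 0) :
    ⟪su2Quat C₀, su2Quat N₀⟫ = 0 := by
  rw [Quaternion.inner_def]
  simp [Quaternion.re_mul, hC]
  linarith

/-- ★★ **QUADRATIC GROWTH OF THE RING DEFICIT ON THE ANCHOR SLICE.**  `L ≥ 2`, `z ≠ 0` with `z k₀ = true`, reference data `(λ, N₀, C₀, s)` as in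
Cor B; a ring `P` with quaternion LEFT-chart coordinates `(a, b)` at `R_s` (`su2Quat P_{i,e} = e^{a_{i,e}}·su2Quat(combFlat w_s e)`,
`su2Quat(P.2 x) = e^{b_x}·su2Quat(λ_x C₀)`) lying in the ANCHOR SLICE — `a 0 e = 0` on tree links, `b 0 ∈ ℝ·su2Quat C₀`,
`a 0 ((−1,−1,−1), k₀) ⊥ su2Quat C₀` — and uniformly small, `‖a i e‖, ‖b x‖ ≤ 1/(10⁷ L¹¹)`.  Then
`Σ_i Σ_e ‖a i e‖² + Σ_x ‖b x‖² ≤ 10²² · L³³ · F_z(P)`. [cite: Luscher1983, §2] [cite: GonzalezarroyoAltes1988, §2] -/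
theorem ringDeficit_quadratic_growth_anchorSlice {L : ℕ} [NeZero L] (hL : 2 ≤ L) (z : Fin 3 → Bool) (hz : z ≠ fun _ => false)
    {k₀ : Fin 3} (hk₀ : z k₀ = true)
    {lam : Site 3 L → SU2} (hlamc : ∀ x, lam x ∈ Subgroup.center SU2) (hlam0 : lam 0 = 1)
    (hlamflip : ∀ (x : Site 3 L) (k : Fin 3), (x k = 0 ∨ x k = -1) → lam (x.shift k) = lam x * centreElem (z k))
    (hlamstay : ∀ (x : Site 3 L) (k : Fin 3), x k ≠ 0 → x k ≠ -1 → lam (x.shift k) = lam x)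
    {N₀ C₀ : SU2} (hN : (su2Quat N₀).re = 0) (hC : (su2Quat C₀).re = 0)
    (hNC : (su2Quat N₀).imI * (su2Quat C₀).imI + (su2Quat N₀).imJ * (su2Quat C₀).imJ + (su2Quat N₀).imK * (su2Quat C₀).imK = 0)
    (s : Fin 3 → Bool) {a : Fin (2 * L - 1 + 1) → Edge 3 L → ℍ} {b : Site 3 L → ℍ}
    (hatree : ∀ e : Edge 3 L, treeEdge e = true → a 0 e = 0) {t : ℝ} (hb0 : b 0 = t • su2Quat C₀)
    (ha0 : ⟪a 0 (((fun _ => (-1 : ZMod L)), k₀) : Edge 3 L), su2Quat C₀⟫ = 0)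
    (hasmall : ∀ i e, ‖a i e‖ ≤ 1 / (10 ^ 7 * (L : ℝ) ^ 11)) (hbsmall : ∀ x, ‖b x‖ ≤ 1 / (10 ^ 7 * (L : ℝ) ^ 11))
    {P : (Fin (2 * L - 1 + 1) → GaugeConfig 3 L SU2) × (Site 3 L → SU2)}
    (hP1 : ∀ i e, su2Quat (P.1 i e) = exp (a i e) * su2Quat (combFlat (fun k => centreElem (s k) * (if z k then N₀ else 1)) e))
    (hP2 : ∀ x, su2Quat (P.2 x) = exp (b x) * su2Quat (lam x * C₀)) :
    (∑ i, ∑ e, ‖a i e‖ ^ 2) + ∑ x, ‖b x‖ ^ 2 ≤ 10 ^ 22 * (L : ℝ) ^ 33 * ringDeficit L z P := by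
  set w : Fin 3 → SU2 := fun k => centreElem (s k) * (if z k then N₀ else 1) with hw
  obtain ⟨Q, hQ⟩ : ∃ Q : ℝ, Q = (∑ i, ∑ e, ‖a i e‖ ^ 2) + ∑ x, ‖b x‖ ^ 2 := ⟨_, rfl⟩
  rw [← hQ]
  have hQ0 : 0 ≤ Q := by rw [hQ]; positivity
  have hF0 : 0 ≤ ringDeficit L z P := ringDeficit_nonneg z P
  have hL1 : (1 : ℝ) ≤ L := by exact_mod_cast NeZero.one_le
  have hL0 : (0 : ℝ) < L := by linarith
  -- sizes
  have hcard : (Fintype.card (Fin (2 * L - 1 + 1)) : ℝ) = 2 * L := by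
    rw [Fintype.card_fin]
    have h : 2 * L - 1 + 1 = 2 * L := Nat.sub_add_cancel (by have := NeZero.one_le (n := L); omega)
    rw [h]; push_cast; ring
  have hsingle_a : ∀ i e, ‖a i e‖ ^ 2 ≤ Q := fun i e => by
    rw [hQ]
    have h1 : ‖a i e‖ ^ 2 ≤ ∑ e', ‖a i e'‖ ^ 2 := Finset.single_le_sum (f := fun e' => ‖a i e'‖ ^ 2) (fun _ _ => by positivity) (Finset.mem_univ e)
    have h2 : ∑ e', ‖a i e'‖ ^ 2 ≤ ∑ i', ∑ e', ‖a i' e'‖ ^ 2 :=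
      Finset.single_le_sum (f := fun i' => ∑ e', ‖a i' e'‖ ^ 2) (fun _ _ => by positivity) (Finset.mem_univ i)
    have h3 : (0 : ℝ) ≤ ∑ x, ‖b x‖ ^ 2 := by positivity
    linarith
  have hsingle_b : ∀ x, ‖b x‖ ^ 2 ≤ Q := fun x => by
    rw [hQ]
    have h1 : ‖b x‖ ^ 2 ≤ ∑ x', ‖b x'‖ ^ 2 := Finset.single_le_sum (f := fun x' => ‖b x'‖ ^ 2) (fun _ _ => by positivity) (Finset.mem_univ x)
    have h3 : (0 : ℝ) ≤ ∑ i, ∑ e, ‖a i e‖ ^ 2 := by positivity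
    linarith
  have hQsmall : Q * (10 ^ 12 * (L : ℝ) ^ 17) ≤ 1 := by
    have hm0 : ∀ i e, ‖a i e‖ ^ 2 ≤ (1 / (10 ^ 7 * (L : ℝ) ^ 11)) ^ 2 := fun i e => pow_le_pow_left₀ (norm_nonneg _) (hasmall i e) 2
    have hm1 : ∀ x, ‖b x‖ ^ 2 ≤ (1 / (10 ^ 7 * (L : ℝ) ^ 11)) ^ 2 := fun x => pow_le_pow_left₀ (norm_nonneg _) (hbsmall x) 2
    have ha : (∑ i, ∑ e, ‖a i e‖ ^ 2) ≤ (2 * L) * (3 * (L : ℝ) ^ 3) * (1 / (10 ^ 7 * (L : ℝ) ^ 11)) ^ 2 := by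
      calc (∑ i, ∑ e, ‖a i e‖ ^ 2) ≤ ∑ i : Fin (2 * L - 1 + 1), ∑ e : Edge 3 L, (1 / (10 ^ 7 * (L : ℝ) ^ 11)) ^ 2 :=
            Finset.sum_le_sum fun i _ => Finset.sum_le_sum fun e _ => hm0 i e
        _ = (2 * L) * (3 * (L : ℝ) ^ 3) * (1 / (10 ^ 7 * (L : ℝ) ^ 11)) ^ 2 := by
            rw [Finset.sum_const, Finset.sum_const, Finset.card_univ, Finset.card_univ, FemtoTransferGap.card_edge_three, smul_smul,
              nsmul_eq_mul, Nat.cast_mul, hcard]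
            push_cast; ring
    have hb : ∑ x, ‖b x‖ ^ 2 ≤ (L : ℝ) ^ 3 * (1 / (10 ^ 7 * (L : ℝ) ^ 11)) ^ 2 := by
      calc ∑ x, ‖b x‖ ^ 2 ≤ ∑ x : Site 3 L, (1 / (10 ^ 7 * (L : ℝ) ^ 11)) ^ 2 := Finset.sum_le_sum fun x _ => hm1 x
        _ = (L : ℝ) ^ 3 * (1 / (10 ^ 7 * (L : ℝ) ^ 11)) ^ 2 := by
            rw [Finset.sum_const, Finset.card_univ, FemtoTransferGap.TwoLattice.Electric.card_site, nsmul_eq_mul]; push_cast; ring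
    have hQle : Q ≤ 7 * (L : ℝ) ^ 4 * (1 / (10 ^ 7 * (L : ℝ) ^ 11)) ^ 2 := by
      rw [hQ]; nlinarith [pow_le_pow_right₀ hL1 (by norm_num : 3 ≤ 4)]
    have e : 7 * (L : ℝ) ^ 4 * (1 / (10 ^ 7 * (L : ℝ) ^ 11)) ^ 2 * (10 ^ 12 * (L : ℝ) ^ 17) = 7 / (100 * L) := by
      field_simp; ring
    calc Q * (10 ^ 12 * (L : ℝ) ^ 17) ≤ 7 * (L : ℝ) ^ 4 * (1 / (10 ^ 7 * (L : ℝ) ^ 11)) ^ 2 * (10 ^ 12 * (L : ℝ) ^ 17) :=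
          mul_le_mul_of_nonneg_right hQle (by positivity)
      _ = 7 / (100 * L) := e
      _ ≤ 1 := by rw [div_le_one (by positivity)]; linarith
  -- the matrix chart data for Cor B
  have hm : Real.sqrt (2 * Q) ≤ 1 / (32 * (L : ℝ) ^ 3) := by
    have h1 : 2 * Q ≤ (1 / (32 * (L : ℝ) ^ 3)) ^ 2 := by
      have hL17 : (L : ℝ) ^ 6 ≤ (L : ℝ) ^ 17 := pow_le_pow_right₀ hL1 (by norm_num)
      have : 2 * Q * (1024 * (L : ℝ) ^ 6) ≤ 1 := by nlinarith [pow_nonneg hL0.le 6]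
      rw [show (1 / (32 * (L : ℝ) ^ 3)) ^ 2 = 1 / (1024 * (L : ℝ) ^ 6) by field_simp; ring, le_div_iff₀ (by positivity)]
      exact this
    calc Real.sqrt (2 * Q) ≤ Real.sqrt ((1 / (32 * (L : ℝ) ^ 3)) ^ 2) := Real.sqrt_le_sqrt h1
      _ = 1 / (32 * (L : ℝ) ^ 3) := Real.sqrt_sq (by positivity)
  have hA : ∀ i e, ‖quatMatrix (a i e)‖ ≤ Real.sqrt (2 * Q) := fun i e => by
    rw [frob_norm_quatMatrix, ← Real.sqrt_sq (norm_nonneg (a i e)), ← Real.sqrt_mul (by norm_num)]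
    exact Real.sqrt_le_sqrt (by nlinarith [hsingle_a i e])
  have hB : ∀ x, ‖quatMatrix (b x)‖ ≤ Real.sqrt (2 * Q) := fun x => by
    rw [frob_norm_quatMatrix, ← Real.sqrt_sq (norm_nonneg (b x)), ← Real.sqrt_mul (by norm_num)]
    exact Real.sqrt_le_sqrt (by nlinarith [hsingle_b x])
  have hP1' : ∀ i e, (P.1 i e : Matrix (Fin 2) (Fin 2) ℂ) = exp (quatMatrix (a i e)) * ((combFlat w e : SU2) : Matrix (Fin 2) (Fin 2) ℂ) := by
    intro i e
    rw [← quatMatrix_su2Quat (P.1 i e), hP1 i e, quatMatrix_mul, quatMatrix_exp, quatMatrix_su2Quat]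
  have hP2' : ∀ x, (P.2 x : Matrix (Fin 2) (Fin 2) ℂ) = exp (quatMatrix (b x)) * ((lam x * C₀ : SU2) : Matrix (Fin 2) (Fin 2) ℂ) := by
    intro x
    rw [← quatMatrix_su2Quat (P.2 x), hP2 x, quatMatrix_mul, quatMatrix_exp, quatMatrix_su2Quat]
  -- Cor B
  obtain ⟨ξ, hskew, htr, hineq⟩ := exists_skew_linearised_le_sqrt_ringDeficit hL z hz hlamc hlam0 hlamflip hlamstay hN hC hNC s hm
    hA hB hP1' hP2'
  -- the gauge mode in quaternion letters
  obtain ⟨η, hη⟩ := exists_pure_family_quatMatrix_eq hskew htr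
  obtain ⟨S, hS⟩ : ∃ S : ℝ, S = (∑ i, ∑ e : Edge 3 L, ‖a i e + (η e.1 - su2Quat (combFlat w e) * η (e.1.shift e.2) * star (su2Quat (combFlat w e)))‖ ^ 2) +
      ∑ x, ‖b x + (η x - su2Quat (lam x * C₀) * η x * star (su2Quat (lam x * C₀)))‖ ^ 2 := ⟨_, rfl⟩
  have hS0 : 0 ≤ S := by rw [hS]; positivity
  have hterm1 : ∀ i (e : Edge 3 L), ‖quatMatrix (a i e) + (ξ e.1 - ((combFlat w e : SU2) : Matrix (Fin 2) (Fin 2) ℂ) * ξ (e.1.shift e.2) *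
      ((combFlat w e : SU2) : Matrix (Fin 2) (Fin 2) ℂ)ᴴ)‖ ^ 2 =
      2 * ‖a i e + (η e.1 - su2Quat (combFlat w e) * η (e.1.shift e.2) * star (su2Quat (combFlat w e)))‖ ^ 2 := by
    intro i e
    rw [← (hη e.1).2, ← (hη (e.1.shift e.2)).2, ← quatMatrix_su2Quat (combFlat w e), quatMatrix_gaugeMode, frob_norm_quatMatrix, mul_pow,
      Real.sq_sqrt (by norm_num)]
  have hterm2 : ∀ x, ‖quatMatrix (b x) + (ξ x - ((lam x * C₀ : SU2) : Matrix (Fin 2) (Fin 2) ℂ) * ξ x *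
      ((lam x * C₀ : SU2) : Matrix (Fin 2) (Fin 2) ℂ)ᴴ)‖ ^ 2 = 2 * ‖b x + (η x - su2Quat (lam x * C₀) * η x * star (su2Quat (lam x * C₀)))‖ ^ 2 := by
    intro x
    rw [← (hη x).2, ← quatMatrix_su2Quat (lam x * C₀), quatMatrix_gaugeMode, frob_norm_quatMatrix, mul_pow, Real.sq_sqrt (by norm_num)]
  have hsum : (∑ i, ∑ e : Edge 3 L, ‖quatMatrix (a i e) + (ξ e.1 - ((combFlat w e : SU2) : Matrix (Fin 2) (Fin 2) ℂ) * ξ (e.1.shift e.2) *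
      ((combFlat w e : SU2) : Matrix (Fin 2) (Fin 2) ℂ)ᴴ)‖ ^ 2) +
      ∑ x, ‖quatMatrix (b x) + (ξ x - ((lam x * C₀ : SU2) : Matrix (Fin 2) (Fin 2) ℂ) * ξ x * ((lam x * C₀ : SU2) : Matrix (Fin 2) (Fin 2) ℂ)ᴴ)‖ ^ 2
      = 2 * S := by
    rw [hS, mul_add, Finset.mul_sum, Finset.mul_sum]
    congr 1
    · refine Finset.sum_congr rfl fun i _ => ?_
      rw [Finset.mul_sum]
      exact Finset.sum_congr rfl fun e _ => hterm1 i e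
    · exact Finset.sum_congr rfl fun x _ => hterm2 x
  have hcor : Real.sqrt (2 * S) ≤ Real.sqrt (220000 * (L : ℝ) ^ 8 * ringDeficit L z P) +
      2500 * (L : ℝ) ^ 4 * (2 * Q + 110000 * (L : ℝ) ^ 8 * ringDeficit L z P) := by
    have h := hineq
    rw [hsum, Real.sq_sqrt (by positivity)] at h
    exact h
  -- the angle lemma
  have hQS : Q ≤ 9600 * (L : ℝ) ^ 9 * S := by
    have hrtree : ∀ e : Edge 3 L, treeEdge e = true → su2Quat (combFlat w e) = 1 := fun e he => by
      rw [combFlat_apply_of_tree w he, FemtoTransferGap.su2Quat_one]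
    have he₀ : su2Quat (combFlat w (((fun _ => (-1 : ZMod L)), k₀) : Edge 3 L)) = su2Quat N₀ ∨
        su2Quat (combFlat w (((fun _ => (-1 : ZMod L)), k₀) : Edge 3 L)) = -su2Quat N₀ := by
      have hWe : combFlat w (((fun _ => (-1 : ZMod L)), k₀) : Edge 3 L) = centreElem (s k₀) * N₀ := by
        rw [combFlat_apply, if_pos (show ((fun _ => (-1 : ZMod L)) : Site 3 L) k₀ = -1 from rfl)]
        show w k₀ = _
        simp only [hw, hk₀]; rfl
      rw [hWe, su2Quat_centreElem_mul]
      cases s k₀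
      · left; simp
      · right; simp
    have hg0 : su2Quat (lam 0 * C₀) = su2Quat C₀ := by rw [hlam0, one_mul]
    have hang := anchorSlice_angle (ι := Fin (2 * L - 1 + 1)) (0 : Fin (2 * L - 1 + 1)) (r := fun e => su2Quat (combFlat w e))
      (g := fun x => su2Quat (lam x * C₀)) (fun e => norm_su2Quat _) (fun x => norm_su2Quat _) hrtree hC (norm_su2Quat C₀) hN
      (norm_su2Quat N₀) (inner_su2Quat_CN_eq_zero hC hNC) hg0 he₀ hatree hb0 ha0 (η := η) (fun x => (hη x).1)
    rw [← hQ, ← hS, hcard] at hang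
    calc Q ≤ 2400 * (2 * (L : ℝ)) ^ 2 * (L : ℝ) ^ 7 * S := hang
      _ = 9600 * (L : ℝ) ^ 9 * S := by ring
  exact growth_arith hL1 hQ0 hS0 hF0 hQS hcor hQsmall

end Summit.QuantumFields.YangMills.Theorems.VirialFluxGap.AnchorSlice
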